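import Summits.BirchSwinnertonDyer.Rank1Residual.X2.GreenbergVatsalReductionDatum
import Summits.BirchSwinnertonDyer.Rank1Residual.Additive.SubGordHigherOrdinary
import Summits.BirchSwinnertonDyer.Rank1Residual.Additive.SpecialJOrdinary
import Literature.NumberTheory.EllipticCurves.HasseWeilAbelianConductorSwanIndependenceTwoProofs
import Literature.NumberTheory.EllipticCurves.EmertonPollackWeston2006.NearlyOrdinaryAlgebraicTransfer
import HarnessLib

/-!
# T-ROL-G F-C1: a GOOD MODEL of a potentially good curve at `v ∋ p` over the valuation ring of
# `K̄_v` (Deuring), its `j`-invariant, and the residues of its `c₄`, `c₆` when `j ≡ 0` / `j ≡ 1728`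
# (team n1011, row T-ROL-G; seat p05 GEN 5; lead R5-57; referee-1 ACK-1 GEN 16)

HONEST FRAMING (cell `b2b-bsdres`, run/shared/lean/b2b/bsd-rank1-residual/, verbatim in every
file): the goal of the cell is to DELETE the COMBINATION-SHAPED residual classes of the
Birch–Swinnerton-Dyer formula for ALL analytic-rank `≤ 1` elliptic curves over `ℚ` — "full BSD
formula for every rank `≤ 1` curve in class `C`" assembled STRICTLY from published theorems — so
that the rank-`≤ 1` remainder becomes exactly the CONSTRUCTION-SHAPED classes, which are TYPED
(missing-input `Prop`s), NOT attempted. This is not "finishing BSD". Team n1011 (N10/N11): research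
route on the CONSTRUCTION-SHAPED classes X3♯(G-ord)/X4♯(G-ord); prove what is provable now; no
claim beyond stated classes; census output = EVIDENCE, never a Literature fact; RESIDUAL-MAP marks
UNCHANGED; nothing is booked by this file. TOOL theorems only: NO definition, NO named fact, NO
conjecture node.

## What

Inputs of the row's assembly file `GordRamifiedOrdinaryLineHigher` (F-C2), for `E = W/ℚ` elliptic
and the place `v ∋ p`, in the good-model vocabulary of F-A (`C : VariableChange K̄_v`,
`W₀ : WeierstrassCurve (specVal v).integer`, `C • (W.baseChange ℚ_v).baseChange K̄_v = W₀.baseChange K̄_v`,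
`IsUnit W₀.Δ`):

* §1 `valuation_le_one_iff_padicValRat`, `specVal_algebraMap_rat_iff` — `ord_p` of a rational
  number versus the place `v` and the spectral valuation of `K̄_v` (bookkeeping over Mathlib's
  `Rat.HeightOneSpectrum.valuation_equiv_padicValuation`, `valuedAdicCompletion_eq_valuation'`).
* §2 **`exists_goodModel_of_padicValRat_j_nonneg`** — a good model from `ord_p j(E) ≥ 0`, `p ≠ 3`
  (the tree's Deuring form `exists_variableChange_eq_baseChange_isUnit_Δ_of_val_j_le_one`, *AEC*
  VII.5.5 with Appendix A Prop. 1.3); `goodModel_j` (`j(W₀) = j(E)` in `K̄_v`, Mathlib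
  `variableChange_j`/`map_j`); **`residue_c₄_eq_zero_of_goodModel`** (`j(E) = 0` or `ord_p j(E) > 0`
  ⟹ `c̃₄(W₀) = 0`, i.e. `j̃ = 0`: Kodaira `IV, IV*, II, II*`), **`residue_c₆_eq_zero_of_goodModel`**
  (`j(E) = 1728` or `ord_p (j(E) − 1728) > 0` ⟹ `c̃₆(W₀) = 0`, i.e. `j̃ = 1728`: Kodaira `III, III*`)
  — the instance-free hypotheses of F-B `GordHigherOrdinaryPoint`.

References: J. H. Silverman, *AEC* 2nd ed. III.1 (c₄, c₆, j), VII.5.5, Appendix A Prop. 1.3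
[SilvermanAEC2009]; M. Deuring, Abh. Math. Sem. Hamburg 14 (1941); cells/n1011/skel/T-ROL-G.md
(fa05b6d488a62a53); additive-p2 `SubGordHigherOrdinary.lean` (the `e ↦ j̃` dictionary).
-/

noncomputable section

open scoped Classical NNReal NumberField

open WeierstrassCurve

universe u

namespace Summit.BirchSwinnertonDyer.Rank1Residual.Additive.GoodModelLine

open NumberField IsDedekindDomain Field IsDedekindDomain.HeightOneSpectrum
  Literature.NumberTheory.GaloisRepresentations Literature.NumberTheory.EllipticCurves
  Literature.NumberTheory.EllipticCurves.GreenbergSelmer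
  Literature.NumberTheory.EllipticCurves.EmertonPollackWeston2006
  Literature.NumberTheory.EllipticCurves.Rank1Residual
  Literature.NumberTheory.EllipticCurves.Rank1Residual.Typed
  Summit.BirchSwinnertonDyer.Rank1Residual.X2.GreenbergVatsalReductionDatum

variable (W : WeierstrassCurve ℚ) [W.IsElliptic] (p : ℕ) [hp : Fact p.Prime]
  {v : HeightOneSpectrum (𝓞 ℚ)}

/-! ## §1 Rational numbers in the spectral valuation of `K̄_v` -/

omit [W.IsElliptic] in
/-- For the place `v ∋ p` of `ℚ`: `v(x) ≤ 1 ↔ 0 ≤ ord_p x` and `v(x) < 1 ↔ 0 < ord_p x` for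
`x ≠ 0` (Mathlib's `Rat.HeightOneSpectrum.valuation_equiv_padicValuation`). [folklore] -/
theorem valuation_le_one_iff_padicValRat (hpv : ((p : ℕ) : 𝓞 ℚ) ∈ v.asIdeal) {x : ℚ} (hx : x ≠ 0) :
    (v.valuation ℚ x ≤ 1 ↔ 0 ≤ padicValRat p x) ∧ (v.valuation ℚ x < 1 ↔ 0 < padicValRat p x) := by
  haveI : Fact (Nat.Prime ((Rat.HeightOneSpectrum.primesEquiv v : Nat.Primes) : ℕ)) :=
    ⟨(Rat.HeightOneSpectrum.primesEquiv v).2⟩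
  have hequiv := Rat.HeightOneSpectrum.valuation_equiv_padicValuation v
  have hq : ((Rat.HeightOneSpectrum.primesEquiv v : Nat.Primes) : ℕ) = p :=
    Rat.HeightOneSpectrum.primesEquiv_eq_of_natCast_mem v hp.out hpv
  constructor
  · rw [Valuation.isEquiv_iff_val_le_one.mp hequiv, padicValuation_apply_of_ne_zero _ hx,
      ← WithZero.exp_zero, WithZero.exp_le_exp, hq]
    constructor <;> intro h <;> linarith
  · rw [Valuation.isEquiv_iff_val_lt_one.mp hequiv, padicValuation_apply_of_ne_zero _ hx,
      ← WithZero.exp_zero, WithZero.exp_lt_exp, hq]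
    constructor <;> intro h <;> linarith

omit [W.IsElliptic] hp in
/-- The spectral valuation of `K̄_v` extends `v` on `ℚ`: `|x|_v ≤ 1 ↔ v(x) ≤ 1` and
`|x|_v < 1 ↔ v(x) < 1`. [folklore] -/
theorem specVal_algebraMap_rat_iff (x : ℚ) :
    (specVal v (algebraMap ℚ (AlgebraicClosure (v.adicCompletion ℚ)) x) ≤ 1 ↔ v.valuation ℚ x ≤ 1) ∧
    (specVal v (algebraMap ℚ (AlgebraicClosure (v.adicCompletion ℚ)) x) < 1 ↔ v.valuation ℚ x < 1) := by
  have h1 : algebraMap ℚ (AlgebraicClosure (v.adicCompletion ℚ)) x =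
      algebraMap (v.adicCompletion ℚ) (AlgebraicClosure (v.adicCompletion ℚ))
        (algebraMap ℚ (v.adicCompletion ℚ) x) :=
    IsScalarTower.algebraMap_apply ℚ (v.adicCompletion ℚ) (AlgebraicClosure (v.adicCompletion ℚ)) x
  have hv' : Valued.v (algebraMap ℚ (v.adicCompletion ℚ) x) = v.valuation ℚ x :=
    valuedAdicCompletion_eq_valuation' v x
  constructor
  · rw [h1, spectralValuation_algebraMap_le_one_iff (specVal_spec v), mem_adicCompletionIntegers, hv']
  · rw [h1, ← NNReal.coe_lt_coe, coe_spectralValuation_algebraMap (specVal_spec v), NNReal.coe_one,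
      Valued.toNormedField.norm_lt_one_iff, hv']

/-! ## §2 A good model of a (G)-curve at `v ∋ p` (Deuring), and the residues of its `c₄`, `c₆` -/

/-- **A GOOD MODEL over `𝒪_w ⊂ K̄_v` from `ord_p j ≥ 0`** (`p ≠ 3`): the tree's Deuring form
`exists_variableChange_eq_baseChange_isUnit_Δ_of_val_j_le_one` (*AEC* VII.5.5 with Appendix A
Prop. 1.3) applied to `E ⊗ K̄_v`. [cite: SilvermanAEC2009, Prop. VII.5.5, Appendix A Prop. 1.3] -/
theorem exists_goodModel_of_padicValRat_j_nonneg (hpv : ((p : ℕ) : 𝓞 ℚ) ∈ v.asIdeal) (hp3 : p ≠ 3)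
    (hj : 0 ≤ padicValRat p W.j) :
    ∃ (C : VariableChange (AlgebraicClosure (v.adicCompletion ℚ)))
      (W₀ : WeierstrassCurve (specVal v).integer),
      C • (W.baseChange (v.adicCompletion ℚ)).baseChange (AlgebraicClosure (v.adicCompletion ℚ)) =
        W₀.baseChange (AlgebraicClosure (v.adicCompletion ℚ)) ∧ IsUnit W₀.Δ := by
  have h3 : specVal v (3 : AlgebraicClosure (v.adicCompletion ℚ)) = 1 := by
    have h := spectralValuation_intCast_eq_one_of_natCast_mem hpv (specVal_spec v) (n := 3)
      (by
        intro h
        have := (Nat.prime_dvd_prime_iff_eq hp.out Nat.prime_three).mp (by exact_mod_cast h)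
        exact hp3 this)
    exact_mod_cast h
  have hjX : ((W.baseChange (v.adicCompletion ℚ)).baseChange (AlgebraicClosure (v.adicCompletion ℚ))).j =
      algebraMap ℚ (AlgebraicClosure (v.adicCompletion ℚ)) W.j := by
    rw [show ((W.baseChange (v.adicCompletion ℚ)).baseChange (AlgebraicClosure (v.adicCompletion ℚ))).j =
        algebraMap (v.adicCompletion ℚ) (AlgebraicClosure (v.adicCompletion ℚ))
          (W.baseChange (v.adicCompletion ℚ)).j from (W.baseChange (v.adicCompletion ℚ)).map_j _,
      show (W.baseChange (v.adicCompletion ℚ)).j = algebraMap ℚ (v.adicCompletion ℚ) W.j from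
        W.map_j _, ← IsScalarTower.algebraMap_apply]
  have hjw : specVal v
      ((W.baseChange (v.adicCompletion ℚ)).baseChange (AlgebraicClosure (v.adicCompletion ℚ))).j ≤ 1 := by
    rw [hjX]
    by_cases hj0 : W.j = 0
    · rw [hj0, map_zero, map_zero]; exact zero_le_one
    · exact (specVal_algebraMap_rat_iff (v := v) W.j).1.mpr
        ((valuation_le_one_iff_padicValRat p hpv hj0).1.mpr hj)
  obtain ⟨C, W₀, hW₀, hΔ⟩ :=
    exists_variableChange_eq_baseChange_isUnit_Δ_of_val_j_le_one h3 _ hjw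
  exact ⟨C, W₀, hW₀, hΔ⟩

/-- The `j`-invariant of a good model is that of `E`. [folklore] -/
theorem goodModel_j {C : VariableChange (AlgebraicClosure (v.adicCompletion ℚ))}
    {W₀ : WeierstrassCurve (specVal v).integer}
    (hW₀ : C • (W.baseChange (v.adicCompletion ℚ)).baseChange (AlgebraicClosure (v.adicCompletion ℚ)) =
      W₀.baseChange (AlgebraicClosure (v.adicCompletion ℚ))) (hΔ : IsUnit W₀.Δ) :
    haveI : W₀.IsElliptic := ⟨hΔ⟩
    algebraMap (specVal v).integer (AlgebraicClosure (v.adicCompletion ℚ)) W₀.j =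
      algebraMap ℚ (AlgebraicClosure (v.adicCompletion ℚ)) W.j := by
  haveI : W₀.IsElliptic := ⟨hΔ⟩
  have h1 : (W₀.baseChange (AlgebraicClosure (v.adicCompletion ℚ))).j =
      algebraMap (specVal v).integer (AlgebraicClosure (v.adicCompletion ℚ)) W₀.j := W₀.map_j _
  have h2 : (C • (W.baseChange (v.adicCompletion ℚ)).baseChange
      (AlgebraicClosure (v.adicCompletion ℚ))).j = algebraMap ℚ (AlgebraicClosure (v.adicCompletion ℚ)) W.j := by
    rw [variableChange_j,
      show ((W.baseChange (v.adicCompletion ℚ)).baseChange (AlgebraicClosure (v.adicCompletion ℚ))).j =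
        algebraMap (v.adicCompletion ℚ) (AlgebraicClosure (v.adicCompletion ℚ))
          (W.baseChange (v.adicCompletion ℚ)).j from (W.baseChange (v.adicCompletion ℚ)).map_j _,
      show (W.baseChange (v.adicCompletion ℚ)).j = algebraMap ℚ (v.adicCompletion ℚ) W.j from
        W.map_j _, ← IsScalarTower.algebraMap_apply]
  rw [← h1, ← h2]
  simp_rw [hW₀]

/-- **`j̃(W₀) = 0` when `ord_p j(E) > 0` (or `j(E) = 0`)**: the residue of `c₄(W₀)` vanishes.
[folklore] -/
theorem residue_c₄_eq_zero_of_goodModel (hpv : ((p : ℕ) : 𝓞 ℚ) ∈ v.asIdeal)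
    {C : VariableChange (AlgebraicClosure (v.adicCompletion ℚ))}
    {W₀ : WeierstrassCurve (specVal v).integer}
    (hW₀ : C • (W.baseChange (v.adicCompletion ℚ)).baseChange (AlgebraicClosure (v.adicCompletion ℚ)) =
      W₀.baseChange (AlgebraicClosure (v.adicCompletion ℚ))) (hΔ : IsUnit W₀.Δ)
    (hj : W.j = 0 ∨ 0 < padicValRat p W.j) :
    IsLocalRing.residue (specVal v).integer W₀.c₄ = 0 := by
  haveI : W₀.IsElliptic := ⟨hΔ⟩
  have hv0 : (specVal v).Integers (specVal v).integer := Valuation.integer.integers _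
  haveI := isElliptic_map_residue (W := W₀) hΔ
  -- `|j(W₀)|_v < 1`
  have hlt : specVal v (algebraMap (specVal v).integer (AlgebraicClosure (v.adicCompletion ℚ)) W₀.j) < 1 := by
    rw [goodModel_j W hW₀ hΔ]
    rcases hj with hj0 | hjpos
    · rw [hj0, map_zero, map_zero]; exact zero_lt_one
    · have hj0 : W.j ≠ 0 := fun h ↦ by
        rw [h, padicValRat.zero] at hjpos; exact lt_irrefl _ hjpos
      exact (specVal_algebraMap_rat_iff (v := v) W.j).2.mpr
        ((valuation_le_one_iff_padicValRat p hpv hj0).2.mpr hjpos)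
  -- so `j(W₀) ∈ 𝔪_w` and `j(W̃₀) = 0`, `c₄(W̃₀) = 0`
  have hres : IsLocalRing.residue (specVal v).integer W₀.j = 0 := by
    rw [IsLocalRing.residue_eq_zero_iff, IsLocalRing.mem_maximalIdeal, mem_nonunits_iff,
      hv0.isUnit_iff_valuation_eq_one]
    exact ne_of_lt hlt
  have hjred : (W₀.map (IsLocalRing.residue (specVal v).integer)).j = 0 := by rw [map_j, hres]
  rw [← map_c₄]
  exact (WeierstrassCurve.j_eq_zero_iff _).mp hjred

/-- **`j̃(W₀) = 1728` when `ord_p (j(E) − 1728) > 0` (or `j(E) = 1728`)**: the residue of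
`c₆(W₀)` vanishes. [folklore] -/
theorem residue_c₆_eq_zero_of_goodModel (hpv : ((p : ℕ) : 𝓞 ℚ) ∈ v.asIdeal)
    {C : VariableChange (AlgebraicClosure (v.adicCompletion ℚ))}
    {W₀ : WeierstrassCurve (specVal v).integer}
    (hW₀ : C • (W.baseChange (v.adicCompletion ℚ)).baseChange (AlgebraicClosure (v.adicCompletion ℚ)) =
      W₀.baseChange (AlgebraicClosure (v.adicCompletion ℚ))) (hΔ : IsUnit W₀.Δ)
    (hj : W.j = 1728 ∨ 0 < padicValRat p (W.j - 1728)) :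
    IsLocalRing.residue (specVal v).integer W₀.c₆ = 0 := by
  haveI : W₀.IsElliptic := ⟨hΔ⟩
  have hv0 : (specVal v).Integers (specVal v).integer := Valuation.integer.integers _
  haveI := isElliptic_map_residue (W := W₀) hΔ
  -- `|j(W₀) − 1728|_v < 1`
  have hlt : specVal v (algebraMap (specVal v).integer (AlgebraicClosure (v.adicCompletion ℚ))
      (W₀.j - 1728)) < 1 := by
    rw [map_sub, goodModel_j W hW₀ hΔ, map_ofNat, show (1728 : AlgebraicClosure (v.adicCompletion ℚ)) =
      algebraMap ℚ (AlgebraicClosure (v.adicCompletion ℚ)) 1728 from (map_ofNat _ 1728).symm, ← map_sub]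
    rcases hj with hj0 | hjpos
    · rw [hj0, sub_self, map_zero, map_zero]; exact zero_lt_one
    · have hj0 : W.j - 1728 ≠ 0 := fun h ↦ by
        rw [h, padicValRat.zero] at hjpos; exact lt_irrefl _ hjpos
      exact (specVal_algebraMap_rat_iff (v := v) (W.j - 1728)).2.mpr
        ((valuation_le_one_iff_padicValRat p hpv hj0).2.mpr hjpos)
  have hres : IsLocalRing.residue (specVal v).integer (W₀.j - 1728) = 0 := by
    rw [IsLocalRing.residue_eq_zero_iff, IsLocalRing.mem_maximalIdeal, mem_nonunits_iff,
      hv0.isUnit_iff_valuation_eq_one]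
    exact ne_of_lt hlt
  have hjred : (W₀.map (IsLocalRing.residue (specVal v).integer)).j = 1728 := by
    rw [map_j, ← sub_eq_zero, ← map_ofNat (IsLocalRing.residue (specVal v).integer) 1728, ← map_sub,
      hres]
  rw [← map_c₆]
  exact (SpecialJ.j_eq_iff_c₆_eq_zero _).mp hjred

end Summit.BirchSwinnertonDyer.Rank1Residual.Additive.GoodModelLine

end
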